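import Summits.QuantumFields.BalabanUV.Beta.CoclosedCovectorLinearRowsNear
import Summits.QuantumFields.BalabanUV.Beta.CompositeVertexKernelLiftKernel

/-!
# `BalabanUV.Beta.CoclosedCovectorCompositeRows` — binder row D1 ∕ (C1) OWNER an2 (gen 63), PART 20: **ON A BOUNDED COARSE CO-CLOSED COVECTOR THE
# `m`-LEVEL COMPOSITE LINEARISATION OF WINDOW-SUPPORTED BRICKS PAIRS LIKE THE STRAIGHT `L^m`-CONTOUR COUNT** — the general-depth twin of an2 g60's
# one-level rows (`CoclosedCovectorLinearRows{,Near}`): if every brick `ℓ i` of a family pairs, on bounded co-closed covectors, like `cℓ ·` the straight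
# block-contour count (`symLinKerAt`, `linKerAt`: `cℓ = (L^{d+1})⁻¹`), then for every `m` and every finest bond `f`
# `⟨ψ, compLinKer ℓ L m f ·⟩ = cℓ^m · ⟨ψ, straightCount (L^m) · · f⟩` — brick-, root- and corrector-free.  The currency in which the row's transported
# multiplier response `λ′ᴿ_k = Σ Λ′_N · compLinKer ℓ Lc (j−k)` (PARTs 15–19) and the END wrapper's (K1) right side are STRAIGHT PULLBACKS of `Λ′_N`.

HONEST FRAMING (cell charter, verbatim): «discharging `BetaPertH` makes Bałaban's UV stability UNCONDITIONAL — a real constructive-QFT result; it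
is NOT the continuum limit and NOT the Clay problem.»  THIS MODULE DISCHARGES NOTHING of `BetaPertH` ∕ row D1: [folklore] summation by parts and re-indexing
on `ℤ^{d+1}` over the cell's OWN typed first-order objects, BY NAME — F6a's top-peeled `CompositeVertexKernelRec.compLinKer` (`compLinKer_succ ∕ _eq_zero`), F6a″'s
finite upper boxes (`CompositeVertexKernelLiftKernel.mem_piFinset_of_mem_winF`), the lead's `AffineAveraging.contourSum` with its SEMIGROUP law
`ResolventComposition.contourSum_mul` (`𝒬_{ML} = 𝒬_L ∘ 𝒬_M`) and INTERTWINING `AffineAveraging.contourSum_dz` (`𝒬 ∘ d = d ∘ blockSum`), the count table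
`AveragingHessianKernels.straightCount` (`straightCount_le`), an2 g60's one-level rows `CoclosedCovectorLinearRowsNear.lip1_symLinKerAt_of_bounded ∕ lip1_linKerAt_of_bounded`
and `CoclosedCovectorLinearRows.lip1_dz_eq_zero_of_bounded`, the pairing `KKTFluctuationEnergy.lip1` with `ResolventComposition.lip1_sum_right'`.  0 `def`, 0 `def … : Prop`,
0 sorry, nothing cited; no table VALUE, no estimate.  NOT (C1), NOT K1, NOT D1, NEVER «G-an2-4 closed», NOT BetaPertH, NOT continuum, NOT Clay.

WHY (row D1 OWNER, gen 63; journal [AN2-G63-ONLINE] J-NOTE-1).  The END wrapper (`FP/StepRecursionFeedNestedNamedB ∕ …NamedC`) DISPLAYS the (J-Λ) rows `K1 ∕ hlink`;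
read through the row's PARTs 15–19 their weights are the TRANSPORTED responses `λ′ᴿ_k (κ,s) = Σ_ν Σ'_w Λ′_N (ν,w) · compLinKer ℓ Lc (j−k) (κ,s) (ν,w)` at the
(0.4)-symmetrised bricks, and `Λ′_N μ y` is a bounded COARSE CO-CLOSED covector (g60 `StraightColumnK1Row.codiff₁_lamCovector`).  g60 proved the ONE-level
sentence (Engine C K1.md §6 (ii)); THIS FILE iterates it: §1 the STRAIGHT PULLBACK `ψ♯ (κ,s) := ⟨ψ, straightCount L · · (κ,s)⟩` of a bounded co-closed covector is
bounded and CO-CLOSED (its codifferential at `x` is `⟨ψ, contourSum L (dz δ_x)⟩ = ⟨ψ, dz (blockSum L δ_x)⟩ = 0`); §2 straight counts COMPOSE (kernel face of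
`contourSum_mul`), so `⟨ψ♯, straightCount (L^m) · · f⟩ = ⟨ψ, straightCount (L^{m+1}) · · f⟩`; §3 induction over `compLinKer_succ` (top peel, window sum over F6a″'s
finite upper box, `lip1_sum_right'`).  NOT HERE: the record instance (`Λ′_N` co-closed and bounded, `λ′ᴿ_k` in closed form — PART 21), the periodisation, (K1).

WHAT (all [folklore]; lattice dimension `d + 1`; `⟨ψ, B⟩ := KKTFluctuationEnergy.lip1 ψ B = Σ'_y Σ_μ ψ μ y · B μ y`):
* §1 `lip1_eq_sum_of_support_right` (a pairing against a finitely supported ROW is a finite sum), `straightCount_eq_zero_of_not_mem` ∕ `card_supportBox` ∕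
  `abs_straightCount_real_le` (support box of `2^{d+1}` coarse sites; `0 ≤ straightCount ≤ L^{d+1}·L`), `abs_lip1_straightCount_le` (the pullback is bounded by
  `2^{d+1}·(d+1)·M·(L^{d+1}·L)`), `sum_δ1_sub_δ1_eq_dz` (`Σ_κ (δ_{(κ,x−e_κ)} − δ_{(κ,x)}) = dz δ_x`), `summable_blockSum_indicator`, **`codiff₁_lip1_straightCount`**
  (the pullback of a bounded co-closed covector is co-closed).
* §2 `sum_mul_straightCount_eq_contourSum` (`Σ_{g ∈ G} F g · straightCount L b g = contourSum L F b` for `F` supported in `G`), `straightCount_eq_zero_of_not_mem_prod`,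
  **`straightCount_pow_succ_eq_sum`** (composition of straight counts), **`lip1_pullback_straightCount_pow`** (`⟨ψ♯, straightCount (L^m) · · f⟩ = ⟨ψ, straightCount (L^{m+1}) · · f⟩`).
* §3 `sum_window_eq_sum_box` (top-peel window sum = sum over the finite upper box), `lip1_compLinKer_succ` (one peel: `⟨ψ, compLinKer ℓ L (m+1) f ·⟩ = cℓ·⟨ψ♯, compLinKer ℓ L m f ·⟩`),
  `compLinKer_zero_eq_straightCount_one` (base), **`lip1_compLinKer_of_bounded`**, **`lip1_compLinKer_symLinKerAt_of_bounded`**, **`lip1_compLinKer_linKerAt_of_bounded`**,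
  `lip1_compLinKer_symLinKerAt_eq_linKerAt_of_bounded` (the two brick sets have the same bounded co-closed moments at all depths), `summable_mul_compLinKer`,
  `tsum_sum_mul_compLinKer_symLinKerAt_of_bounded` (the record's `Σ_ν Σ'_w` order).

HONEST DEPENDENCY (verbatim): «continuum YM on T⁴ ⇐ BetaPertH ∧ nine spine estimates (0/9 proved); BetaPertH ⇐ (D1) ∧ (D4) ∧ CAP+tail;
G-an2-4 gates asym, D1 and NE2/3/4.»  ABSOLUTE RULE (cell, verbatim): «No internally-minted statement may enter as a cited fact. Every
hypothesis is either kernel-proved in this package or a verbatim quotation of a PUBLISHED theorem with page reference.»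
Unit `b2b-balaban-beta-an2` gen 63 (row-D1 owner), 2026-08-27; `bears_on: R4-O/T1|T1a` (a (C1)-side identity behind the displayed rows (K1) ∕ `hlink`; moves no
node counter).  No existing file touched.
-/

noncomputable section

namespace Summit.QuantumFields.BalabanUV.Beta.CoclosedCovectorCompositeRows

open Finset
open scoped BigOperators
open Literature.MathematicalPhysics.QuantumFieldTheory.Balaban1983to89.Beta
open AffineAveraging (Form0 Form1 Site unitVec dz codiff₁ box toSite contourSum blockSum contourSum_dz)
open AveragingHessianKernels (Bond Near δ1 δ1_apply straightCount straightCount_le straightCount_nonneg)  open AveragingHessianKernelsRooted (linKerAt linKerAt_eq_zero)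
open TransportedContourVariables (mapForm mapForm_apply)  open KKTFluctuationEnergy (lip1)  open ResolventComposition (contourSum_mul lip1_sum_right')
open Summit.QuantumFields.BalabanUV.Beta.SymAveragingHessianCounts (symLinKerAt symLinKerAt_eq_zero)
open Summit.QuantumFields.BalabanUV.Beta.CoclosedCovectorLinearRows (straightCount_real lip1_dz_eq_zero_of_bounded)
open Summit.QuantumFields.BalabanUV.Beta.CoclosedCovectorLinearRowsNear (straightCount_eq_zero_of_not_near mem_piFinset_of_near summable_of_near
  lip1_symLinKerAt_of_bounded lip1_linKerAt_of_bounded lip1_const_mul_right)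
open Summit.QuantumFields.BalabanUV.Beta.CompositeVertexKernelRec (compLinKer compLinKer_zero compLinKer_succ compLinKer_eq_zero offs winF wid
  near_iff_exists_offs smul_add_right_injective)
open Summit.QuantumFields.BalabanUV.Beta.CompositeVertexKernelLiftKernel (mem_piFinset_of_mem_winF)

variable {d : ℕ}

/-! ## §1 The straight pullback of a bounded co-closed covector is bounded and co-closed -/

section Pullback

/-- [folklore] A pairing against a ROW supported (in the coarse site) in the finite set `S` is a finite sum over `S`. -/
theorem lip1_eq_sum_of_support_right (ψ B : Form1 (d + 1) ℝ) {S : Finset (Site (d + 1))} (hS : ∀ μ, ∀ y ∉ S, B μ y = 0) :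
    lip1 ψ B = ∑ y ∈ S, ∑ μ, ψ μ y * B μ y := by
  unfold lip1
  exact tsum_eq_sum fun y hy => Finset.sum_eq_zero fun μ _ => by rw [hS μ y hy, mul_zero]

/-- [folklore] The straight count rows of a fixed fine bond are supported in the explicit finite box of its base point (`0 < L`). -/
theorem straightCount_eq_zero_of_not_mem {L : ℕ} (hL : 0 < L) (u : Bond (d + 1)) (μ : Fin (d + 1)) {y : Site (d + 1)}
    (hy : y ∉ Fintype.piFinset fun i => Finset.Icc (u.2 i / (L : ℤ) - 1) (u.2 i / (L : ℤ))) :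
    (straightCount L μ y u : ℝ) = 0 := by
  rw [straightCount_eq_zero_of_not_near μ (fun h => hy (mem_piFinset_of_near hL h)), Int.cast_zero]

/-- [folklore] The support box of a fine point has `2^{d+1}` coarse sites. -/
theorem card_supportBox (L : ℕ) (x : Site (d + 1)) :
    (Fintype.piFinset fun i => Finset.Icc (x i / (L : ℤ) - 1) (x i / (L : ℤ))).card = 2 ^ (d + 1) := by
  rw [Fintype.card_piFinset]
  have h : ∀ i : Fin (d + 1), (Finset.Icc (x i / (L : ℤ) - 1) (x i / (L : ℤ))).card = 2 := fun i => by
    rw [Int.card_Icc]; omega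
  simp only [h, prod_const, card_univ, Fintype.card_fin]

/-- [folklore] The straight count is at most `L^{d+1}·L` in absolute value (as a real number; `straightCount_nonneg`, `straightCount_le`). -/
theorem abs_straightCount_real_le (L : ℕ) (μ : Fin (d + 1)) (y : Site (d + 1)) (u : Bond (d + 1)) :
    |(straightCount L μ y u : ℝ)| ≤ (L : ℝ) ^ (d + 1) * L := by
  rw [abs_of_nonneg (by exact_mod_cast straightCount_nonneg L μ y u)]
  exact_mod_cast straightCount_le L μ y u

/-- [folklore] **THE STRAIGHT PULLBACK OF A BOUNDED COVECTOR IS BOUNDED**: `|⟨ψ, straightCount L · · u⟩| ≤ 2^{d+1}·(d+1)·M·(L^{d+1}·L)` (`0 < L`). -/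
theorem abs_lip1_straightCount_le {ψ : Form1 (d + 1) ℝ} {M : ℝ} (hψ : ∀ μ y, |ψ μ y| ≤ M) {L : ℕ} (hL : 0 < L) (u : Bond (d + 1)) :
    |lip1 ψ (fun μ y => (straightCount L μ y u : ℝ))| ≤ (2 : ℝ) ^ (d + 1) * ((d + 1 : ℕ) : ℝ) * M * ((L : ℝ) ^ (d + 1) * L) := by
  have hM : 0 ≤ M := (abs_nonneg _).trans (hψ 0 0)
  rw [lip1_eq_sum_of_support_right ψ _ (fun μ y hy => straightCount_eq_zero_of_not_mem hL u μ hy)]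
  refine (abs_sum_le_sum_abs _ _).trans ?_
  refine (sum_le_sum fun y _ => (abs_sum_le_sum_abs _ _).trans
    (sum_le_sum fun μ _ => show |ψ μ y * (straightCount L μ y u : ℝ)| ≤ M * ((L : ℝ) ^ (d + 1) * L) from ?_)).trans ?_
  · rw [abs_mul]; exact mul_le_mul (hψ μ y) (abs_straightCount_real_le L μ y u) (abs_nonneg _) hM
  · rw [sum_const, sum_const, card_univ, Fintype.card_fin, card_supportBox, nsmul_eq_mul, nsmul_eq_mul]; push_cast; exact le_of_eq (by ring)

/-- [folklore] The fine codifferential stencil of indicator rows is the coarse gradient of the point indicator: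
`Σ_κ (δ_{(κ, x − e_κ)} − δ_{(κ, x)}) = dz δ_x` (as real 1-forms). -/
theorem sum_δ1_sub_δ1_eq_dz (x : Site (d + 1)) :
    (fun κ' z => ∑ κ : Fin (d + 1), (mapForm (Int.castAddHom ℝ) (δ1 (κ, x - unitVec κ)) κ' z - mapForm (Int.castAddHom ℝ) (δ1 (κ, x)) κ' z))
      = dz (fun z : Site (d + 1) => if z = x then (1 : ℝ) else 0) := by
  funext κ' z
  rw [Finset.sum_eq_single κ' (fun κ _ hκ => ?_) (fun h => absurd (Finset.mem_univ κ') h)]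
  · simp only [mapForm_apply, δ1_apply, Prod.mk.injEq, true_and, dz, Int.coe_castAddHom]
    by_cases h1 : z = x - unitVec κ' <;> by_cases h2 : z = x
    · exfalso; have := congr_fun (h2.symm.trans h1) κ'; simp [AffineAveraging.unitVec_apply] at this; omega
    · rw [if_pos h1, if_neg h2, if_pos (by rw [h1]; abel), if_neg h2]; simp
    · rw [if_neg h1, if_pos h2, if_neg (by rw [h2]; intro h; have := congr_fun h κ'; simp [AffineAveraging.unitVec_apply] at this), if_pos h2]; simp
    · rw [if_neg h1, if_neg h2, if_neg (fun h => h1 (by rw [← h]; abel)), if_neg h2]; simp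
  · simp only [mapForm_apply, δ1_apply, Prod.mk.injEq]
    rw [if_neg (fun h => hκ h.1.symm), if_neg (fun h => hκ h.1.symm), sub_self]

/-- [folklore] The block sum of a point indicator is finitely supported, hence summable (`0 < L`). -/
theorem summable_blockSum_indicator {L : ℕ} (hL : 0 < L) (x : Site (d + 1)) :
    Summable (blockSum L (fun z : Site (d + 1) => if z = x then (1 : ℝ) else 0)) := by
  refine summable_of_near hL x fun y hy => Finset.sum_eq_zero fun b hb => if_neg fun h => hy fun i => ?_
  have hb' : b i < L := by simpa [AffineAveraging.box, Fintype.mem_piFinset, Finset.mem_range] using (Fintype.mem_piFinset.1 hb) i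
  have hi := congr_fun h i
  simp only [Pi.add_apply, Pi.smul_apply, smul_eq_mul, toSite] at hi
  constructor <;> omega

/-- [folklore] **`codiff₁_lip1_straightCount` — THE STRAIGHT PULLBACK OF A BOUNDED CO-CLOSED COVECTOR IS CO-CLOSED** (`0 < L`): the coarse codifferential of
`(κ, s) ↦ ⟨ψ, straightCount L · · (κ, s)⟩` at `x` is `⟨ψ, contourSum L (dz δ_x)⟩ = ⟨ψ, dz (blockSum L δ_x)⟩ = 0` — the dual of the intertwining `contourSum_dz`. -/
theorem codiff₁_lip1_straightCount {ψ : Form1 (d + 1) ℝ} {M : ℝ} (hψ : ∀ μ y, |ψ μ y| ≤ M) (hco : codiff₁ ψ = 0) {L : ℕ} (hL : 0 < L) :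
    codiff₁ (fun κ s => lip1 ψ (fun μ y => (straightCount L μ y (κ, s) : ℝ))) = 0 := by
  funext x
  simp only [codiff₁, Pi.zero_apply]
  have hrow : ∀ u : Bond (d + 1), (fun μ y => (straightCount L μ y u : ℝ)) = contourSum L (mapForm (Int.castAddHom ℝ) (δ1 u)) := fun u => by
    funext μ y; exact straightCount_real L μ y u
  have hsum : ∀ u : Bond (d + 1), ∀ μ, Summable fun y => ψ μ y * contourSum L (mapForm (Int.castAddHom ℝ) (δ1 u)) μ y := fun u μ =>
    summable_of_near hL u.2 fun y hy => by rw [← straightCount_real, straightCount_eq_zero_of_not_near μ hy, Int.cast_zero, mul_zero]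
  simp only [hrow]
  have hA : ∀ κ : Fin (d + 1), Summable fun y => ∑ μ, ψ μ y * contourSum L (mapForm (Int.castAddHom ℝ) (δ1 (κ, x - unitVec κ))) μ y :=
    fun κ => summable_sum fun μ _ => hsum (κ, x - unitVec κ) μ
  have hB : ∀ κ : Fin (d + 1), Summable fun y => ∑ μ, ψ μ y * contourSum L (mapForm (Int.castAddHom ℝ) (δ1 (κ, x))) μ y :=
    fun κ => summable_sum fun μ _ => hsum (κ, x) μ
  have h1 : ∑ κ : Fin (d + 1), (lip1 ψ (contourSum L (mapForm (Int.castAddHom ℝ) (δ1 (κ, x - unitVec κ))))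
        - lip1 ψ (contourSum L (mapForm (Int.castAddHom ℝ) (δ1 (κ, x)))))
      = lip1 ψ (fun μ y => ∑ κ : Fin (d + 1), (contourSum L (mapForm (Int.castAddHom ℝ) (δ1 (κ, x - unitVec κ))) μ y
          - contourSum L (mapForm (Int.castAddHom ℝ) (δ1 (κ, x))) μ y)) := by
    calc ∑ κ : Fin (d + 1), (lip1 ψ (contourSum L (mapForm (Int.castAddHom ℝ) (δ1 (κ, x - unitVec κ))))
            - lip1 ψ (contourSum L (mapForm (Int.castAddHom ℝ) (δ1 (κ, x)))))
        = ∑ κ : Fin (d + 1), ∑' y, ∑ μ, (ψ μ y * contourSum L (mapForm (Int.castAddHom ℝ) (δ1 (κ, x - unitVec κ))) μ y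
            - ψ μ y * contourSum L (mapForm (Int.castAddHom ℝ) (δ1 (κ, x))) μ y) := by
          refine Finset.sum_congr rfl fun κ _ => ?_
          unfold lip1
          rw [← (hA κ).tsum_sub (hB κ)]
          exact tsum_congr fun y => by rw [← Finset.sum_sub_distrib]
      _ = ∑' y, ∑ κ : Fin (d + 1), ∑ μ, (ψ μ y * contourSum L (mapForm (Int.castAddHom ℝ) (δ1 (κ, x - unitVec κ))) μ y
            - ψ μ y * contourSum L (mapForm (Int.castAddHom ℝ) (δ1 (κ, x))) μ y) :=
          (Summable.tsum_finsetSum fun κ _ => ((hA κ).sub (hB κ)).congr fun y => by rw [← Finset.sum_sub_distrib]).symm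
      _ = _ := by
          unfold lip1
          refine tsum_congr fun y => ?_
          rw [Finset.sum_comm]
          exact Finset.sum_congr rfl fun μ _ => by rw [Finset.mul_sum]; exact Finset.sum_congr rfl fun κ _ => by ring
  rw [h1]
  have h2 : (fun μ y => ∑ κ : Fin (d + 1), (contourSum L (mapForm (Int.castAddHom ℝ) (δ1 (κ, x - unitVec κ))) μ y
          - contourSum L (mapForm (Int.castAddHom ℝ) (δ1 (κ, x))) μ y))
      = contourSum L (dz (fun z : Site (d + 1) => if z = x then (1 : ℝ) else 0)) := by
    rw [← sum_δ1_sub_δ1_eq_dz x]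
    funext μ y
    simp only [contourSum, ← Finset.sum_sub_distrib]
    conv_lhs => rw [Finset.sum_comm]
    exact Finset.sum_congr rfl fun b _ => Finset.sum_comm
  rw [h2, contourSum_dz]
  exact lip1_dz_eq_zero_of_bounded hψ hco (summable_blockSum_indicator hL x)

end Pullback

/-! ## §2 Straight counts compose (the kernel face of `contourSum_mul`) -/

section Compose

/-- [folklore] **THE ROWS OF `contourSum` ARE THE STRAIGHT COUNTS**: for a real 1-form `F` supported (as a function of the bond) in the finite set `G`,
`Σ_{g ∈ G} F g · straightCount L ν w g = contourSum L F ν w`. -/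
theorem sum_mul_straightCount_eq_contourSum {L : ℕ} (F : Form1 (d + 1) ℝ) (G : Finset (Bond (d + 1))) (hG : ∀ κ s, (κ, s) ∉ G → F κ s = 0)
    (ν : Fin (d + 1)) (w : Site (d + 1)) :
    ∑ g ∈ G, F g.1 g.2 * (straightCount L ν w g : ℝ) = contourSum L F ν w := by
  have hsc : ∀ g : Bond (d + 1), (straightCount L ν w g : ℝ)
      = ∑ b ∈ box (d + 1) L, ∑ t ∈ Finset.range L, if (ν, (L : ℤ) • w + toSite b + (t : ℤ) • unitVec ν) = g then (1 : ℝ) else 0 := by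
    intro g
    rw [straightCount_real]
    simp only [contourSum, mapForm_apply, δ1_apply]
    refine sum_congr rfl fun b _ => sum_congr rfl fun t _ => ?_
    split_ifs <;> simp
  simp_rw [hsc, Finset.mul_sum]
  rw [Finset.sum_comm]
  refine sum_congr rfl fun b _ => ?_
  rw [Finset.sum_comm]
  refine sum_congr rfl fun t _ => ?_
  simp_rw [mul_ite, mul_one, mul_zero]
  rw [Finset.sum_ite_eq]
  split_ifs with h; · rfl
  exact (hG _ _ h).symm

/-- [folklore] The straight count rows of a fixed fine bond at blocking `N` are supported in the finite product box `univ ×ˢ Box_N(f)`. -/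
theorem straightCount_eq_zero_of_not_mem_prod {N : ℕ} (hN : 0 < N) (f : Bond (d + 1)) (κ : Fin (d + 1)) (s : Site (d + 1))
    (h : (κ, s) ∉ (Finset.univ : Finset (Fin (d + 1))) ×ˢ (Fintype.piFinset fun i => Finset.Icc (f.2 i / (N : ℤ) - 1) (f.2 i / (N : ℤ)))) :
    (straightCount N κ s f : ℝ) = 0 :=
  straightCount_eq_zero_of_not_mem hN f κ fun hs => h (Finset.mem_product.2 ⟨Finset.mem_univ κ, hs⟩)

/-- [folklore] **`straightCount_pow_succ_eq_sum` — STRAIGHT COUNTS COMPOSE** (`0 < L`): `straightCount (L^{m+1}) ν w f = Σ_{g} straightCount (L^m) g f · straightCount L ν w g`,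
the sum written over the finite box carrying the inner count (the kernel face of the semigroup law `contourSum_mul`: `𝒬_{L^m·L} = 𝒬_L ∘ 𝒬_{L^m}`). -/
theorem straightCount_pow_succ_eq_sum {L : ℕ} (hL : 0 < L) (m : ℕ) (f : Bond (d + 1)) (ν : Fin (d + 1)) (w : Site (d + 1)) :
    (straightCount (L ^ (m + 1)) ν w f : ℝ)
      = ∑ g ∈ (Finset.univ : Finset (Fin (d + 1))) ×ˢ (Fintype.piFinset fun i => Finset.Icc (f.2 i / ((L ^ m : ℕ) : ℤ) - 1) (f.2 i / ((L ^ m : ℕ) : ℤ))),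
          (straightCount (L ^ m) g.1 g.2 f : ℝ) * straightCount L ν w g := by
  rw [sum_mul_straightCount_eq_contourSum (fun κ s => (straightCount (L ^ m) κ s f : ℝ)) _
      (fun κ s h => straightCount_eq_zero_of_not_mem_prod (pow_pos hL m) f κ s h) ν w,
    show (fun κ s => (straightCount (L ^ m) κ s f : ℝ)) = contourSum (L ^ m) (mapForm (Int.castAddHom ℝ) (δ1 f)) from
      funext fun κ => funext fun s => straightCount_real (L ^ m) κ s f,
    ← congr_fun (congr_fun (contourSum_mul (L ^ m) L (pow_pos hL m) (mapForm (Int.castAddHom ℝ) (δ1 f))) ν) w, ← pow_succ,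
    straightCount_real]

/-- [folklore] **`lip1_pullback_straightCount_pow` — THE PULLBACK COMPOSES WITH THE STRAIGHT COUNT**: `⟨ψ♯, straightCount (L^m) · · f⟩ = ⟨ψ, straightCount (L^{m+1}) · · f⟩`
for `ψ♯ (κ,s) := ⟨ψ, straightCount L · · (κ,s)⟩` (every covector `ψ`; all sums are finite). -/
theorem lip1_pullback_straightCount_pow (ψ : Form1 (d + 1) ℝ) {L : ℕ} (hL : 0 < L) (m : ℕ) (f : Bond (d + 1)) :
    lip1 (fun κ s => lip1 ψ (fun μ y => (straightCount L μ y (κ, s) : ℝ))) (fun κ s => (straightCount (L ^ m) κ s f : ℝ))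
      = lip1 ψ (fun ν w => (straightCount (L ^ (m + 1)) ν w f : ℝ)) := by
  set G : Finset (Bond (d + 1)) := (Finset.univ : Finset (Fin (d + 1))) ×ˢ
    (Fintype.piFinset fun i => Finset.Icc (f.2 i / ((L ^ m : ℕ) : ℤ) - 1) (f.2 i / ((L ^ m : ℕ) : ℤ))) with hG
  have hsum : ∀ g ∈ G, ∀ μ, Summable fun y => ψ μ y * (fun (g : Bond (d + 1)) (μ' : Fin (d + 1)) (y' : Site (d + 1)) => (straightCount L μ' y' g : ℝ)) g μ y :=
    fun g _ μ => summable_of_near hL g.2 fun y hy => by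
      show ψ μ y * (straightCount L μ y g : ℝ) = 0
      rw [straightCount_eq_zero_of_not_near μ hy, Int.cast_zero, mul_zero]
  calc lip1 (fun κ s => lip1 ψ (fun μ y => (straightCount L μ y (κ, s) : ℝ))) (fun κ s => (straightCount (L ^ m) κ s f : ℝ))
      = ∑ s ∈ Fintype.piFinset (fun i => Finset.Icc (f.2 i / ((L ^ m : ℕ) : ℤ) - 1) (f.2 i / ((L ^ m : ℕ) : ℤ))), ∑ κ,
          lip1 ψ (fun μ y => (straightCount L μ y (κ, s) : ℝ)) * (straightCount (L ^ m) κ s f : ℝ) :=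
        lip1_eq_sum_of_support_right _ _ fun κ s hs => straightCount_eq_zero_of_not_mem (pow_pos hL m) f κ hs
    _ = ∑ g ∈ G, (straightCount (L ^ m) g.1 g.2 f : ℝ) * lip1 ψ (fun μ y => (straightCount L μ y g : ℝ)) := by
        rw [hG, Finset.sum_product, Finset.sum_comm]
        exact sum_congr rfl fun s _ => sum_congr rfl fun κ _ => mul_comm _ _
    _ = lip1 ψ (fun ν w => ∑ g ∈ G, (straightCount (L ^ m) g.1 g.2 f : ℝ) * (straightCount L ν w g : ℝ)) :=
        (lip1_sum_right' G (fun g => (straightCount (L ^ m) g.1 g.2 f : ℝ)) (fun g μ y => (straightCount L μ y g : ℝ)) ψ hsum).symm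
    _ = lip1 ψ (fun ν w => (straightCount (L ^ (m + 1)) ν w f : ℝ)) := by
        congr 1
        funext ν w
        rw [hG, ← straightCount_pow_succ_eq_sum hL m f ν w]

end Compose

/-! ## §3 The induction over the top-peeled composite: `⟨ψ, compLinKer ℓ L m f ·⟩ = cℓ^m·⟨ψ, straightCount (L^m) · · f⟩` -/

section Composite

variable {ℓ : ℕ → Fin (d + 1) → Site (d + 1) → Bond (d + 1) → ℝ} {L : ℕ}

/-- [folklore] **THE TOP-PEEL WINDOW SUM OVER THE FINITE UPPER BOX**: for a brick vanishing off its `Near` window, the window sum of `compLinKer_succ` equals the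
sum over F6a″'s finite upper box of the finest bond (both lose only zero terms; `0 < L`). -/
theorem sum_window_eq_sum_box (hL : 0 < L) (hℓ0 : ∀ i μ y g, ¬ Near L y g.2 → ℓ i μ y g = 0) (m : ℕ) (f : Bond (d + 1))
    (ν : Fin (d + 1)) (w : Site (d + 1)) :
    ∑ κ : Fin (d + 1), ∑ e ∈ offs L, ℓ m ν w (κ, (L : ℤ) • w + e) * compLinKer ℓ L m f (κ, (L : ℤ) • w + e)
      = ∑ g ∈ (Finset.univ : Finset (Fin (d + 1))) ×ˢ
          (Fintype.piFinset fun i => Finset.Icc ((f.2 i - (wid L m : ℤ)) / ((L ^ m : ℕ) : ℤ)) (f.2 i / ((L ^ m : ℕ) : ℤ))),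
            ℓ m ν w g * compLinKer ℓ L m f g := by
  rw [Finset.sum_product]
  refine sum_congr rfl fun κ _ => ?_
  have hwin : ∑ e ∈ offs L, ℓ m ν w (κ, (L : ℤ) • w + e) * compLinKer ℓ L m f (κ, (L : ℤ) • w + e)
      = ∑ γ ∈ (offs L).image (fun e => (L : ℤ) • w + e), ℓ m ν w (κ, γ) * compLinKer ℓ L m f (κ, γ) := by
    rw [Finset.sum_image fun e _ e' _ h => smul_add_right_injective L w h]
  rw [hwin]
  have himg : ∀ γ, γ ∈ (offs L).image (fun e => (L : ℤ) • w + e) ↔ Near L w γ := fun γ => by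
    rw [near_iff_exists_offs, Finset.mem_image]
    exact ⟨fun ⟨e, he, h⟩ => ⟨e, he, h.symm⟩, fun ⟨e, he, h⟩ => ⟨e, he, h.symm⟩⟩
  calc ∑ γ ∈ (offs L).image (fun e => (L : ℤ) • w + e), ℓ m ν w (κ, γ) * compLinKer ℓ L m f (κ, γ)
      = ∑ γ ∈ (offs L).image (fun e => (L : ℤ) • w + e) ∪
          Fintype.piFinset (fun i => Finset.Icc ((f.2 i - (wid L m : ℤ)) / ((L ^ m : ℕ) : ℤ)) (f.2 i / ((L ^ m : ℕ) : ℤ))),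
            ℓ m ν w (κ, γ) * compLinKer ℓ L m f (κ, γ) :=
        Finset.sum_subset Finset.subset_union_left fun γ _ hγ => by
          rw [hℓ0 m ν w (κ, γ) (fun h => hγ ((himg γ).2 h)), zero_mul]
    _ = _ := (Finset.sum_subset Finset.subset_union_right fun γ _ hγ => by
          rw [compLinKer_eq_zero m (f := f) (g := (κ, γ)) (fun h => hγ (mem_piFinset_of_mem_winF (pow_pos hL m) h)), mul_zero]).symm

/-- [folklore] **`lip1_compLinKer_succ` — ONE PEEL**: if the top brick `ℓ m` is window-supported and pairs with the covector `ψ` like `cℓ ·` the straight count, then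
`⟨ψ, compLinKer ℓ L (m+1) f ·⟩ = cℓ · ⟨ψ♯, compLinKer ℓ L m f ·⟩` with `ψ♯ (κ,s) := ⟨ψ, straightCount L · · (κ,s)⟩` (`compLinKer_succ`, the window sum over the finite
upper box, `lip1_sum_right'`). -/
theorem lip1_compLinKer_succ (hL : 0 < L) (hℓ0 : ∀ i μ y g, ¬ Near L y g.2 → ℓ i μ y g = 0) (m : ℕ) {ψ : Form1 (d + 1) ℝ} {cℓ : ℝ}
    (hℓm : ∀ g : Bond (d + 1), lip1 ψ (fun ν w => ℓ m ν w g) = cℓ * lip1 ψ (fun ν w => (straightCount L ν w g : ℝ))) (f : Bond (d + 1)) :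
    lip1 ψ (fun ν w => compLinKer ℓ L (m + 1) f (ν, w))
      = cℓ * lip1 (fun κ s => lip1 ψ (fun μ y => (straightCount L μ y (κ, s) : ℝ))) (fun κ s => compLinKer ℓ L m f (κ, s)) := by
  set G : Finset (Bond (d + 1)) := (Finset.univ : Finset (Fin (d + 1))) ×ˢ
    (Fintype.piFinset fun i => Finset.Icc ((f.2 i - (wid L m : ℤ)) / ((L ^ m : ℕ) : ℤ)) (f.2 i / ((L ^ m : ℕ) : ℤ))) with hG
  have hstep : (fun ν w => compLinKer ℓ L (m + 1) f (ν, w)) = fun ν w => ∑ g ∈ G, compLinKer ℓ L m f g * ℓ m ν w g := by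
    funext ν w
    rw [compLinKer_succ, sum_window_eq_sum_box hL hℓ0 m f ν w]
    exact sum_congr rfl fun g _ => mul_comm _ _
  have hsum : ∀ g ∈ G, ∀ μ, Summable fun y => ψ μ y * (fun (g : Bond (d + 1)) (μ' : Fin (d + 1)) (y' : Site (d + 1)) => ℓ m μ' y' g) g μ y :=
    fun g _ μ => summable_of_near hL g.2 fun y hy => by
      show ψ μ y * ℓ m μ y g = 0
      rw [hℓ0 m μ y g hy, mul_zero]
  rw [hstep, lip1_sum_right' G (fun g => compLinKer ℓ L m f g) (fun g μ y => ℓ m μ y g) ψ hsum]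
  simp_rw [hℓm]
  rw [lip1_eq_sum_of_support_right _ (fun κ s => compLinKer ℓ L m f (κ, s))
      (S := Fintype.piFinset fun i => Finset.Icc ((f.2 i - (wid L m : ℤ)) / ((L ^ m : ℕ) : ℤ)) (f.2 i / ((L ^ m : ℕ) : ℤ)))
      (fun κ s hs => compLinKer_eq_zero m (f := f) (g := (κ, s)) fun h => hs (mem_piFinset_of_mem_winF (pow_pos hL m) h)),
    Finset.mul_sum, hG, Finset.sum_product, Finset.sum_comm]
  exact sum_congr rfl fun s _ => by rw [Finset.mul_sum]; exact sum_congr rfl fun κ _ => by ring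

/-- [folklore] the depth-`0` composite kernel IS the blocking-`1` straight count: both are the indicator of the bond. -/
theorem compLinKer_zero_eq_straightCount_one (f : Bond (d + 1)) (ν : Fin (d + 1)) (w : Site (d + 1)) :
    compLinKer ℓ L 0 f (ν, w) = (straightCount 1 ν w f : ℝ) := by
  rw [compLinKer_zero, straightCount_real]
  simp only [contourSum, AffineAveraging.box, Finset.range_one, mapForm_apply, δ1_apply, Nat.cast_one, one_smul]
  rw [show (Fintype.piFinset fun _ : Fin (d + 1) => ({0} : Finset ℕ)) = {fun _ => 0} from Fintype.piFinset_singleton _]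
  simp only [Finset.sum_singleton, Nat.cast_zero, zero_smul, add_zero]
  rw [show toSite (fun _ : Fin (d + 1) => (0 : ℕ)) = (0 : Site (d + 1)) from funext fun _ => by simp [toSite], add_zero]
  by_cases h : (ν, w) = f
  · rw [if_pos h, if_pos h]; simp
  · rw [if_neg h, if_neg h]; simp

/-- [folklore] **`lip1_compLinKer_of_bounded` — THE `m`-LEVEL COMPOSITE LINEARISATION ON A BOUNDED CO-CLOSED COVECTOR IS THE STRAIGHT `L^m`-CONTOUR COUNT, TIMES `cℓ^m`**:
for a window-supported brick family `ℓ` whose every level pairs, on bounded co-closed covectors, like `cℓ ·` the straight count (`0 < L`), and every bounded co-closed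
`ψ`, every depth `m`, every finest bond `f`: `⟨ψ, compLinKer ℓ L m f ·⟩ = cℓ^m · ⟨ψ, straightCount (L^m) · · f⟩` (induction on `m`: one peel, then the hypothesis at the
PULLBACK covector — bounded by `abs_lip1_straightCount_le`, co-closed by `codiff₁_lip1_straightCount` —, then `lip1_pullback_straightCount_pow`). -/
theorem lip1_compLinKer_of_bounded (hL : 0 < L) (hℓ0 : ∀ i μ y g, ¬ Near L y g.2 → ℓ i μ y g = 0) {cℓ : ℝ}
    (hℓ : ∀ (i : ℕ) (ψ : Form1 (d + 1) ℝ) (M : ℝ), (∀ μ y, |ψ μ y| ≤ M) → codiff₁ ψ = 0 →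
      ∀ g : Bond (d + 1), lip1 ψ (fun ν w => ℓ i ν w g) = cℓ * lip1 ψ (fun ν w => (straightCount L ν w g : ℝ))) :
    ∀ (m : ℕ) {ψ : Form1 (d + 1) ℝ} {M : ℝ}, (∀ μ y, |ψ μ y| ≤ M) → codiff₁ ψ = 0 → ∀ f : Bond (d + 1),
      lip1 ψ (fun ν w => compLinKer ℓ L m f (ν, w)) = cℓ ^ m * lip1 ψ (fun ν w => (straightCount (L ^ m) ν w f : ℝ))
  | 0, ψ, M, _, _, f => by
      rw [pow_zero, one_mul, pow_zero]
      exact congrArg (lip1 ψ) (funext fun ν => funext fun w => compLinKer_zero_eq_straightCount_one f ν w)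
  | m + 1, ψ, M, hψ, hco, f => by
      rw [lip1_compLinKer_succ hL hℓ0 m (hℓ m ψ M hψ hco) f,
        lip1_compLinKer_of_bounded hL hℓ0 hℓ m (fun κ s => abs_lip1_straightCount_le hψ hL (κ, s)) (codiff₁_lip1_straightCount hψ hco hL) f,
        lip1_pullback_straightCount_pow ψ hL m f, pow_succ]
      ring

/-- [folklore] **`lip1_compLinKer_symLinKerAt_of_bounded` — THE (0.4)-SYMMETRISED COMPOSITE ON A BOUNDED CO-CLOSED COVECTOR** (roots `r i` in the block at every level,
`0 < L`): `⟨ψ, compLinKer (i ↦ symLinKerAt (toSite (r i)) L) L m f ·⟩ = ((L^{d+1})⁻¹)^m · ⟨ψ, straightCount (L^m) · · f⟩` — g60's `lip1_symLinKerAt_of_bounded` at every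
level through `lip1_compLinKer_of_bounded`.  The transported multiplier responses `λ′ᴿ` of PARTs 15–19 are such pairings. -/
theorem lip1_compLinKer_symLinKerAt_of_bounded {ψ : Form1 (d + 1) ℝ} {M : ℝ} (hψ : ∀ μ y, |ψ μ y| ≤ M) (hco : codiff₁ ψ = 0) (hL : 0 < L)
    {r : ℕ → (Fin (d + 1) → ℕ)} (hr : ∀ i, r i ∈ box (d + 1) L) (m : ℕ) (f : Bond (d + 1)) :
    lip1 ψ (fun ν w => compLinKer (fun i => symLinKerAt (toSite (r i)) L) L m f (ν, w))
      = (((L : ℝ) ^ (d + 1))⁻¹) ^ m * lip1 ψ (fun ν w => (straightCount (L ^ m) ν w f : ℝ)) :=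
  lip1_compLinKer_of_bounded hL (fun i _ _ _ h => symLinKerAt_eq_zero (hr i) h)
    (fun i _ _ hψ' hco' g => lip1_symLinKerAt_of_bounded hψ' hco' hL (hr i) g) m hψ hco f

/-- [folklore] **`lip1_compLinKer_linKerAt_of_bounded` — THE ROOTED SINGLE-COMB-ORDER COMPOSITE ON A BOUNDED CO-CLOSED COVECTOR** (an1's bricks `linKerAt`; Engine C's
rooted tables): the same closed form `((L^{d+1})⁻¹)^m · ⟨ψ, straightCount (L^m) · · f⟩` (g60's `lip1_linKerAt_of_bounded` at every level). -/
theorem lip1_compLinKer_linKerAt_of_bounded {ψ : Form1 (d + 1) ℝ} {M : ℝ} (hψ : ∀ μ y, |ψ μ y| ≤ M) (hco : codiff₁ ψ = 0) (hL : 0 < L)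
    {r : ℕ → (Fin (d + 1) → ℕ)} (hr : ∀ i, r i ∈ box (d + 1) L) (m : ℕ) (f : Bond (d + 1)) :
    lip1 ψ (fun ν w => compLinKer (fun i => linKerAt (toSite (r i)) L) L m f (ν, w))
      = (((L : ℝ) ^ (d + 1))⁻¹) ^ m * lip1 ψ (fun ν w => (straightCount (L ^ m) ν w f : ℝ)) :=
  lip1_compLinKer_of_bounded hL (fun i _ _ _ h => linKerAt_eq_zero (hr i) h)
    (fun i _ _ hψ' hco' g => lip1_linKerAt_of_bounded hψ' hco' hL (hr i) g) m hψ hco f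

/-- [folklore] **THE SYMMETRISED AND THE ROOTED COMPOSITES HAVE THE SAME BOUNDED CO-CLOSED MOMENTS**, at any two root lists in the block (Engine C's «sh+sym» = «bm+sym»
bookkeeping, first order, all depths). -/
theorem lip1_compLinKer_symLinKerAt_eq_linKerAt_of_bounded {ψ : Form1 (d + 1) ℝ} {M : ℝ} (hψ : ∀ μ y, |ψ μ y| ≤ M) (hco : codiff₁ ψ = 0)
    (hL : 0 < L) {r r' : ℕ → (Fin (d + 1) → ℕ)} (hr : ∀ i, r i ∈ box (d + 1) L) (hr' : ∀ i, r' i ∈ box (d + 1) L) (m : ℕ) (f : Bond (d + 1)) :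
    lip1 ψ (fun ν w => compLinKer (fun i => symLinKerAt (toSite (r i)) L) L m f (ν, w))
      = lip1 ψ (fun ν w => compLinKer (fun i => linKerAt (toSite (r' i)) L) L m f (ν, w)) := by
  rw [lip1_compLinKer_symLinKerAt_of_bounded hψ hco hL hr, lip1_compLinKer_linKerAt_of_bounded hψ hco hL hr']

/-- [folklore] the composite kernel's top slice is finitely supported: for fixed `f` and `ν`, `w ↦ c w · compLinKer ℓ L m f (ν, w)` is summable for EVERY weight (`0 < L`). -/
theorem summable_mul_compLinKer (hL : 0 < L) (m : ℕ) (f : Bond (d + 1)) (ν : Fin (d + 1)) (c : Site (d + 1) → ℝ) :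
    Summable fun w => c w * compLinKer ℓ L m f (ν, w) :=
  summable_of_ne_finset_zero (s := Fintype.piFinset fun i => Finset.Icc ((f.2 i - (wid L m : ℤ)) / ((L ^ m : ℕ) : ℤ)) (f.2 i / ((L ^ m : ℕ) : ℤ)))
    fun w hw => by rw [compLinKer_eq_zero m (f := f) (g := (ν, w)) (fun h => hw (mem_piFinset_of_mem_winF (pow_pos hL m) h)), mul_zero]

/-- [folklore] **`tsum_sum_mul_compLinKer_symLinKerAt_of_bounded` — THE RECORD's ORDER OF SUMMATION** (`Σ_ν Σ'_w`, as PARTs 15–19 write `λ′ᴿ`): for a bounded co-closed `ψ`,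
`Σ_ν Σ'_w ψ ν w · compLinKer (i ↦ symLinKerAt (toSite (r i)) L) L m f (ν,w) = ((L^{d+1})⁻¹)^m · Σ_ν Σ'_w ψ ν w · straightCount (L^m) ν w f`. -/
theorem tsum_sum_mul_compLinKer_symLinKerAt_of_bounded {ψ : Form1 (d + 1) ℝ} {M : ℝ} (hψ : ∀ μ y, |ψ μ y| ≤ M) (hco : codiff₁ ψ = 0) (hL : 0 < L)
    {r : ℕ → (Fin (d + 1) → ℕ)} (hr : ∀ i, r i ∈ box (d + 1) L) (m : ℕ) (f : Bond (d + 1)) :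
    ∑ ν : Fin (d + 1), ∑' w : Site (d + 1), ψ ν w * compLinKer (fun i => symLinKerAt (toSite (r i)) L) L m f (ν, w)
      = (((L : ℝ) ^ (d + 1))⁻¹) ^ m * ∑ ν : Fin (d + 1), ∑' w : Site (d + 1), ψ ν w * (straightCount (L ^ m) ν w f : ℝ) := by
  have h1 : ∑ ν : Fin (d + 1), ∑' w : Site (d + 1), ψ ν w * compLinKer (fun i => symLinKerAt (toSite (r i)) L) L m f (ν, w)
      = lip1 ψ (fun ν w => compLinKer (fun i => symLinKerAt (toSite (r i)) L) L m f (ν, w)) := by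
    unfold lip1
    rw [Summable.tsum_finsetSum fun ν _ => summable_mul_compLinKer hL m f ν (ψ ν)]
  have h2 : ∑ ν : Fin (d + 1), ∑' w : Site (d + 1), ψ ν w * (straightCount (L ^ m) ν w f : ℝ)
      = lip1 ψ (fun ν w => (straightCount (L ^ m) ν w f : ℝ)) := by
    unfold lip1
    rw [Summable.tsum_finsetSum fun ν _ => ?_]
    exact summable_of_near (pow_pos hL m) f.2 fun w hw => by
      show ψ ν w * (straightCount (L ^ m) ν w f : ℝ) = 0
      rw [straightCount_eq_zero_of_not_near ν hw, Int.cast_zero, mul_zero]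
  rw [h1, h2, lip1_compLinKer_symLinKerAt_of_bounded hψ hco hL hr m f]

end Composite


end Summit.QuantumFields.BalabanUV.Beta.CoclosedCovectorCompositeRows

end
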